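import Mathlib
import HarnessLib
import Summits.HubbardSuperconductivity.HubbardSuperconductivity.Theorems.KLProgrammeKLRegimeSplitTwoLegSizesMSOfProfileSplit

/-!
# Route `KLProgramme`, crux K3 — (E3a-MS) supplier, BUDGET-PARAMETRIC form (gen-6 re-key `msBar ↦ msBarQ`, plan g14 (R12) T1b)

Seat hubbard-kl-k3c3-p1 (g4).  The (E3a-MS) slot text exists in several budget keyings — `TwoLegSizesMSFn` (`…SplitFrameFn` l.312,
slot allowance `msBar G Q U n · (Gfr j · uPow j U · 4^{(j-2)m})`, `msBar = klMsKappa · twoLegBar … 1 n`), its gen-6 twin `TwoLegSizesMSFnQ`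
(`…SplitBundleV15`, allowance `msBarQ G Q U n · (…)`, `msBarQ = Q.CE · twoLegBar … 1 n`), and whatever a later budget ruling brings.  The
(L)+(F) supplier chain of k3c3-p1 g3 (`…TwoLegSizesMS*`: profile split → chain profiles → term table → admissible pieces) is
budget-FREE except for the literal right-hand sides of its two fit hypotheses.  This file states the slot text ONCE with the two size
families as parameters,

  `TwoLegSizesMSWith L M β U μ K n b B` := `∃ lp, ℓ_n(K) = lp n + Σ_{m ∈ Ioc n N} lp m ∧ (∀ m, symmetric ∧ C⁴) ∧ (‖Dʲ lp n‖ ≤ b j) ∧ (‖Dʲ lp m‖ ≤ B m j)`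
  (`j ≤ 4`, `m ∈ Ioc n (nScales β)`),

records that the keyed texts are its instances BY `Iff.rfl` (`twoLegSizesMSFn_iff_with`; the `Q`-keyed one in the file that imports
`…SplitBundleV15`), that it is MONOTONE in `(b, B)` (`TwoLegSizesMSWith.mono` — the only place a fit is ever used), and proves the
STRUCTURAL step with the sizes COMPUTED rather than fitted:

**`twoLegSizesMSWith_of_profile_split`**: if `klTwoLegPieceFn … K n = klFrameExtFn μ δ`, `δ = p n + Σ_{m ∈ Ioc n N} p m` with every `p m` `C⁴`,
`2π`-periodic, even, `θ ↦ π/2 − θ`-symmetric, centred angular sizes `‖Dⁱ(p m − mean)‖ ≤ Gs m j` (`i ≤ j ≤ 4`), then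
`TwoLegSizesMSWith … K n (fun j ↦ extSize X |mean (p n)| (Gs n j) j) (fun m j ↦ extSize X |mean (p m)| (Gs m j) j)` where
`extSize X M Γ j = [j=0]·M + (j!)²·(2·j!·X·200ʲ)·Γ·(4 + max 1 ((j−1)!/(8/5)))ʲ` is the numeral of `norm_iteratedFDeriv_onM_piece_le`.

The rest of the chain is re-threaded in `…TwoLegSizesMSWithChain` / `…TwoLegSizesMSWithPieces`; every keyed supplier theorem
(`twoLegSizesMST_succ_of_pieces`, its `Q`-twin, …) is then `(generic).mono fit_n fit_m`.  Proofs only; nothing about the model.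
-/

noncomputable section

namespace Summit.HubbardSuperconductivity.HubbardSuperconductivity.Theorems.KLRegimeSplit

set_option linter.dupNamespace false -- summit = problem name (single-conjunct summit), D-0017

open Real Finset MeasureTheory Literature.MathematicalPhysics.QuantumLattice Literature.MathematicalPhysics.QuantumLattice.FermiRG
open Summit.HubbardSuperconductivity.HubbardSuperconductivity.Theorems.KLProgrammeLegKernels

/-! ## §1 The extension numeral and the budget-parametric slot text -/

/-- **The size of a G-extended profile at order `j`** from a bound `M` on its mean and a bound `Γ` on its centred angular derivatives
up to order `j`: `extSize X M Γ j = [j=0]·M + (j!)²·(2·j!·X·200ʲ)·Γ·(4 + max 1 ((j−1)!/(8/5)))ʲ` — the right-hand side of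
`norm_iteratedFDeriv_onM_piece_le` (`X ≥ sup_{l ≤ j} ‖Dˡχ₂‖`). -/
def extSize (X M Γ : ℝ) (j : ℕ) : ℝ :=
  (if j = 0 then M else 0) +
    (j.factorial : ℝ) ^ 2 * (2 * j.factorial * X * 200 ^ j) * Γ * (4 + max 1 (((j - 1).factorial : ℝ) / (8 / 5))) ^ j

/-- `extSize` unfolded (for rewriting under binders). -/
theorem extSize_eq (X M Γ : ℝ) (j : ℕ) : extSize X M Γ j = (if j = 0 then M else 0) +
    (j.factorial : ℝ) ^ 2 * (2 * j.factorial * X * 200 ^ j) * Γ * (4 + max 1 (((j - 1).factorial : ℝ) / (8 / 5))) ^ j := rfl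

/-- `extSize` is nonnegative for nonnegative data. -/
theorem extSize_nonneg {X M Γ : ℝ} (hX : 0 ≤ X) (hM : 0 ≤ M) (hΓ : 0 ≤ Γ) (j : ℕ) : 0 ≤ extSize X M Γ j := by
  unfold extSize
  have h1 : 0 ≤ (if j = 0 then M else 0) := by split_ifs <;> simp [hM]
  positivity

/-- `extSize` is monotone in the mean bound and in the centred size (`X ≥ 0`). -/
theorem extSize_mono {X M M' Γ Γ' : ℝ} (hX : 0 ≤ X) (hM : M ≤ M') (hΓ : Γ ≤ Γ') (j : ℕ) : extSize X M Γ j ≤ extSize X M' Γ' j := by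
  unfold extSize
  have h1 : (if j = 0 then M else 0) ≤ (if j = 0 then M' else 0) := by split_ifs <;> simp [hM]
  have h2 : 0 ≤ (j.factorial : ℝ) ^ 2 * (2 * j.factorial * X * 200 ^ j) := by positivity
  have h3 : (0 : ℝ) ≤ (4 + max 1 (((j - 1).factorial : ℝ) / (8 / 5))) ^ j := by positivity
  have h4 : (j.factorial : ℝ) ^ 2 * (2 * j.factorial * X * 200 ^ j) * Γ * (4 + max 1 (((j - 1).factorial : ℝ) / (8 / 5))) ^ j ≤
      (j.factorial : ℝ) ^ 2 * (2 * j.factorial * X * 200 ^ j) * Γ' * (4 + max 1 (((j - 1).factorial : ℝ) / (8 / 5))) ^ j :=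
    mul_le_mul_of_nonneg_right (mul_le_mul_of_nonneg_left hΓ h2) h3
  linarith

section Model

variable (L M : ℕ) [NeZero L] [NeZero M]

/-- **(E3a-MS) with the size families as parameters**: `ℓ_n(K) = lp n + Σ_{m ∈ Ioc n (nScales β)} lp m` with symmetric `C⁴` slot functions,
`‖Dʲ lp n‖ ≤ b j` and `‖Dʲ lp m‖ ≤ B m j` for `j ≤ 4`, `m ∈ Ioc n (nScales β)` — the common text of `TwoLegSizesMSFn` (`b j = twoLegBar G Q U j n`,
`B m j = msBar G Q U n · (Gfr j · uPow j U · 4^{(j−2)m})`) and of its `Q`-keyed gen-6 twin (`msBarQ` in place of `msBar`). -/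
def TwoLegSizesMSWith (β U μ : ℝ) (K : FrameFn) (n : ℕ) (b : ℕ → ℝ) (B : ℕ → ℕ → ℝ) : Prop :=
  ∃ lp : ℕ → FrameFn,
    (∀ p : Fin 2 → ℝ, klTwoLegPieceFn L M β U μ K n p = lp n p + ∑ m ∈ Ioc n (nScales β), lp m p) ∧
    (∀ m, IsSymmetricFrame (lp m) ∧ ContDiff ℝ 4 (onM (lp m))) ∧
    (∀ j ≤ 4, ∀ q : Momentum, ‖iteratedFDeriv ℝ j (onM (lp n)) q‖ ≤ b j) ∧
    (∀ m ∈ Ioc n (nScales β), ∀ j ≤ 4, ∀ q : Momentum, ‖iteratedFDeriv ℝ j (onM (lp m)) q‖ ≤ B m j)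

end Model

section MS

variable {L M : ℕ} [NeZero L] [NeZero M] {G : GeoConsts} {Q : EngConsts} {R : RenConsts} {β U μ : ℝ}

/-- **`TwoLegSizesMSFn` is the instance `b = twoLegBar … · n`, `B m j = msBar … n · (Gfr j · uPow j U · 4^{(j−2)m})`** (by `Iff.rfl`). -/
theorem twoLegSizesMSFn_iff_with (K : FrameFn) (n : ℕ) :
    TwoLegSizesMSFn L M G Q R β U μ K n ↔ TwoLegSizesMSWith L M β U μ K n (fun j => twoLegBar G Q U j n)
      (fun m j => msBar G Q U n * (R.Gfr j * uPow j U * (4 : ℝ) ^ (((j : ℤ) - 2) * m))) :=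
  Iff.rfl

/-- The same at `K.eval` (the slot text `TwoLegSizesMST`). -/
theorem twoLegSizesMST_iff_with (K : TrigPolyC4v) (n : ℕ) :
    TwoLegSizesMST L M G Q R β U μ K n ↔ TwoLegSizesMSWith L M β U μ K.eval n (fun j => twoLegBar G Q U j n)
      (fun m j => msBar G Q U n * (R.Gfr j * uPow j U * (4 : ℝ) ^ (((j : ℤ) - 2) * m))) :=
  Iff.rfl

/-- **Monotonicity in the size families** — the only place a FIT is ever used: sizes `(b, B)` within `(b', B')` on the relevant
indices (`j ≤ 4`; `m ∈ Ioc n (nScales β)`) transport the slot text. -/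
theorem TwoLegSizesMSWith.mono {K : FrameFn} {n : ℕ} {b b' : ℕ → ℝ} {B B' : ℕ → ℕ → ℝ}
    (h : TwoLegSizesMSWith L M β U μ K n b B) (hb : ∀ j ≤ 4, b j ≤ b' j)
    (hB : ∀ m ∈ Ioc n (nScales β), ∀ j ≤ 4, B m j ≤ B' m j) : TwoLegSizesMSWith L M β U μ K n b' B' := by
  obtain ⟨lp, hsplit, hsym, hn, hm⟩ := h
  exact ⟨lp, hsplit, hsym, fun j hj q => (hn j hj q).trans (hb j hj), fun m hmI j hj q => (hm m hmI j hj q).trans (hB m hmI j hj)⟩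

/-- From the parametric text with the `msBar` fits to `TwoLegSizesMSFn`. -/
theorem TwoLegSizesMSWith.toMSFn {K : FrameFn} {n : ℕ} {b : ℕ → ℝ} {B : ℕ → ℕ → ℝ}
    (h : TwoLegSizesMSWith L M β U μ K n b B) (hb : ∀ j ≤ 4, b j ≤ twoLegBar G Q U j n)
    (hB : ∀ m ∈ Ioc n (nScales β), ∀ j ≤ 4, B m j ≤ msBar G Q U n * (R.Gfr j * uPow j U * (4 : ℝ) ^ (((j : ℤ) - 2) * m))) :
    TwoLegSizesMSFn L M G Q R β U μ K n :=
  (twoLegSizesMSFn_iff_with K n).2 (h.mono hb hB)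

/-- From the parametric text at `K.eval` with the `msBar` fits to `TwoLegSizesMST`. -/
theorem TwoLegSizesMSWith.toMST {K : TrigPolyC4v} {n : ℕ} {b : ℕ → ℝ} {B : ℕ → ℕ → ℝ}
    (h : TwoLegSizesMSWith L M β U μ K.eval n b B) (hb : ∀ j ≤ 4, b j ≤ twoLegBar G Q U j n)
    (hB : ∀ m ∈ Ioc n (nScales β), ∀ j ≤ 4, B m j ≤ msBar G Q U n * (R.Gfr j * uPow j U * (4 : ℝ) ^ (((j : ℤ) - 2) * m))) :
    TwoLegSizesMST L M G Q R β U μ K n :=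
  h.toMSFn hb hB

/-! ## §2 (E3a-MS), parametric, from a profile split — sizes computed, no fit -/

/-- **(E3a-MS) FROM A PROFILE SPLIT, sizes computed.**  See the module docstring.  The slots are `lp m := klFrameExtFn μ (p m)`; the
decomposition is the linearity of the G-extension (`klFrameExtFn_finset_sum`); symmetry and smoothness are `isSymmetricFrame_piece` /
`contDiff_onM_piece`; the sizes are `norm_iteratedFDeriv_onM_piece_le` fed with the centred angular sizes `Gs m j`, giving
`extSize X |mean (p m)| (Gs m j) j` on EVERY index `m` (the conclusion only reads `m = n` and `m ∈ Ioc n (nScales β)`). -/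
theorem twoLegSizesMSWith_of_profile_split (hμ : μ ∈ klWindowC) {K : FrameFn} {n : ℕ} {δ : ℝ → ℝ}
    (hP : klTwoLegPieceFn L M β U μ K n = klFrameExtFn μ δ) (p : ℕ → ℝ → ℝ)
    (hsplit : ∀ θ, δ θ = p n θ + ∑ m ∈ Ioc n (nScales β), p m θ)
    (hcd : ∀ m, ContDiff ℝ 4 (p m)) (hper : ∀ m, Function.Periodic (p m) (2 * π))
    (heven : ∀ m θ, p m (-θ) = p m θ) (hdiag : ∀ m θ, p m (π / 2 - θ) = p m θ)
    {X : ℝ} (hX : ∀ l ≤ 4, ∀ x : ℝ, ‖iteratedFDeriv ℝ l salmhoferCutoff x‖ ≤ X)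
    (Gs : ℕ → ℕ → ℝ)
    (hGs : ∀ m, ∀ j ≤ 4, ∀ i ≤ j, ∀ t : ℝ, ‖iteratedFDeriv ℝ i (fun t => p m t - klAngularMean (p m)) t‖ ≤ Gs m j) :
    TwoLegSizesMSWith L M β U μ K n (fun j => extSize X |klAngularMean (p n)| (Gs n j) j)
      (fun m j => extSize X |klAngularMean (p m)| (Gs m j) j) := by
  have hμ' : -(39 / 10 : ℝ) ≤ μ := by have := hμ.1; norm_num at this ⊢; linarith
  -- the size of every extended profile
  have hsize : ∀ m, ∀ j ≤ 4, ∀ q : Momentum,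
      ‖iteratedFDeriv ℝ j (onM (klFrameExtFn μ (p m))) q‖ ≤ extSize X |klAngularMean (p m)| (Gs m j) j := fun m j hj q =>
    norm_iteratedFDeriv_onM_piece_le (P := klFrameExtFn μ (p m)) rfl (N := 4) (by exact_mod_cast hcd m) (hper m)
      (j := j) (by exact_mod_cast hj) hμ (hGs m j hj) (fun l hl x => hX l (hl.trans hj) x) q
  refine ⟨fun m => klFrameExtFn μ (p m), fun q => ?_, fun m => ⟨?_, ?_⟩, fun j hj q => hsize n j hj q, fun m _ j hj q => hsize m j hj q⟩
  · -- decomposition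
    have hn : n ∉ Ioc n (nScales β) := by simp
    have hδ : δ = fun θ => ∑ m ∈ insert n (Ioc n (nScales β)), p m θ := by
      funext θ; rw [Finset.sum_insert hn]; exact hsplit θ
    rw [hP, hδ, klFrameExtFn_finset_sum μ _ _ (fun m _ => (hcd m).continuous), Finset.sum_insert hn]
  · exact isSymmetricFrame_piece rfl (hper m) (heven m) (hdiag m) hμ'
  · exact contDiff_onM_piece rfl (N' := 4) (by exact_mod_cast hcd m) (hper m) hμ

/-- **Corollary (the landed fitted form, re-derived)**: the profile split with the two `msBar` fits gives `TwoLegSizesMSFn` — a one-line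
check that `twoLegSizesMSFn_of_profile_split` (`…MSOfProfileSplit`) factors through the parametric statement. -/
theorem twoLegSizesMSFn_of_profile_split' (hμ : μ ∈ klWindowC) {K : FrameFn} {n : ℕ} {δ : ℝ → ℝ}
    (hP : klTwoLegPieceFn L M β U μ K n = klFrameExtFn μ δ) (p : ℕ → ℝ → ℝ)
    (hsplit : ∀ θ, δ θ = p n θ + ∑ m ∈ Ioc n (nScales β), p m θ)
    (hcd : ∀ m, ContDiff ℝ 4 (p m)) (hper : ∀ m, Function.Periodic (p m) (2 * π))
    (heven : ∀ m θ, p m (-θ) = p m θ) (hdiag : ∀ m θ, p m (π / 2 - θ) = p m θ)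
    {X : ℝ} (hX : ∀ l ≤ 4, ∀ x : ℝ, ‖iteratedFDeriv ℝ l salmhoferCutoff x‖ ≤ X)
    (Gs : ℕ → ℕ → ℝ)
    (hGs : ∀ m, ∀ j ≤ 4, ∀ i ≤ j, ∀ t : ℝ, ‖iteratedFDeriv ℝ i (fun t => p m t - klAngularMean (p m)) t‖ ≤ Gs m j)
    (hfit_n : ∀ j ≤ 4, extSize X |klAngularMean (p n)| (Gs n j) j ≤ twoLegBar G Q U j n)
    (hfit_m : ∀ m ∈ Ioc n (nScales β), ∀ j ≤ 4,
      extSize X |klAngularMean (p m)| (Gs m j) j ≤ msBar G Q U n * (R.Gfr j * uPow j U * (4 : ℝ) ^ (((j : ℤ) - 2) * m))) :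
    TwoLegSizesMSFn L M G Q R β U μ K n :=
  (twoLegSizesMSWith_of_profile_split hμ hP p hsplit hcd hper heven hdiag hX Gs hGs).toMSFn hfit_n hfit_m

end MS

end Summit.HubbardSuperconductivity.HubbardSuperconductivity.Theorems.KLRegimeSplit

end
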